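import Summits.ValiantsHypothesis.ValiantsHypothesis.Theorems.NcIntervalProjection
import Summits.ValiantsHypothesis.ValiantsHypothesis.Theorems.NisanPermanent
import HarnessLib

/-!
# The word tensor of the ordered permanent `ncPerPoly n` IS Nisan's `perWord n` (coefficient bridge)

Decomposition workshop `decomp-valiant`, lens 6 «restricted-models lifting axis», gen 4, move K5b of
the node `CommutativityDial`: the decided bottom rung (`Theorems.NisanPermanent`: the noncommutative
ABP width of the word tensor `perWord n` is exactly `C(n, ⌊n/2⌋)`) was stated on Nisan's row-alphabet
tensor `perWord`; this file proves that `perWord` is LITERALLY the coefficient tensor of the free-algebra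
element `CommutativityDial.ncPerPoly n` the dial's conjunct `A_nc = PerNotNcVP` speaks about:

* `coeff_equiv_ncPerPoly` — the coefficient of any word `u` in `ncPerPoly n` (read through
  `FreeAlgebra.equivMonoidAlgebraFreeMonoid`) is `#{π ∈ S_n : u = (π 0,0)(π 1,1)⋯(π (n-1),n-1)}`;
* `coeff_equiv_ncPerPoly_ofFn` — on words of length `n` over the alphabet `Fin n × Fin n`: the coefficient
  of `w` is `perWord n (rows of w)` if `w` is column-consistent (letter in position `t` lies in column `t`)
  and `0` otherwise; `coeff_equiv_ncPerPoly_of_length_ne` — words of other lengths have coefficient `0`.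

Hence every sequential flattening matrix of `ncPerPoly n`'s word tensor is the corresponding flattening
matrix of `perWord n` bordered by zero rows and columns (an inconsistent prefix has only inconsistent
completions), so Nisan's rank/width statements transfer verbatim (`NisanPermanent.ncAbpWidth_perWord`).
HONEST FRAMING: bookkeeping; nothing here bears on `VP ≠ VNP`.

## References
* [Nisan1991Noncommutative] N. Nisan, Lower bounds for non-commutative computation, STOC 1991, §4.
* [HrubesWigdersonYehudayoff2010] P. Hrubeš, A. Wigderson, A. Yehudayoff, Relationless completeness and
  separations, CCC 2010, §1.5 (ordered polynomials).
-/

namespace Summit.ValiantsHypothesis.ValiantsHypothesis.Theorems.NcPerWordTensor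

open Summit.ValiantsHypothesis.ValiantsHypothesis.Theorems.CommutativityDial (ncPerPoly)
open Summit.ValiantsHypothesis.ValiantsHypothesis.Theorems.NcIntervalProjection (equiv_prod_map_ι)
open Summit.ValiantsHypothesis.ValiantsHypothesis.Theorems.NisanPermanent (perWord)

universe u

variable {F : Type u} [Field F]

/-- A product of generators listed by `List.ofFn` is the basis word of that list.
[cite: HrubesWigdersonYehudayoff2010, §1.5] -/
theorem equiv_prod_ofFn_ι {σ : Type*} {m : ℕ} (f : Fin m → σ) :
    FreeAlgebra.equivMonoidAlgebraFreeMonoid ((List.ofFn fun i => FreeAlgebra.ι F (f i)).prod) =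
      MonoidAlgebra.single (FreeMonoid.ofList (List.ofFn f)) (1 : F) := by
  rw [← equiv_prod_map_ι, List.map_ofFn]
  rfl

/-- **Coefficients of the ordered permanent**: the coefficient of the word `u` in `ncPerPoly n` is the
number of permutations `π` whose column-ordered word `(π 0,0)(π 1,1)⋯` equals `u`.
[cite: Nisan1991Noncommutative, §4] -/
theorem coeff_equiv_ncPerPoly (n : ℕ) (u : FreeMonoid (Fin n × Fin n)) :
    (FreeAlgebra.equivMonoidAlgebraFreeMonoid (ncPerPoly (k := F) n)).coeff u =
      ∑ π : Equiv.Perm (Fin n),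
        if List.ofFn (fun t => (π t, t)) = FreeMonoid.toList u then (1 : F) else 0 := by
  classical
  unfold ncPerPoly
  simp only [map_sum, equiv_prod_ofFn_ι, MonoidAlgebra.coeff_sum, Finsupp.finsetSum_apply,
    MonoidAlgebra.coeff_single]
  refine Finset.sum_congr rfl fun π _ => ?_
  rw [Finsupp.single_apply]
  exact if_congr ⟨fun h => by rw [← h]; rfl, fun h => by rw [h]; rfl⟩ rfl rfl

/-- The column-ordered word of `π` equals the word `w` iff `w` is column-consistent and its rows are `π`.
[cite: Nisan1991Noncommutative, §4] -/
theorem ofList_perm_eq_iff {n : ℕ} (π : Equiv.Perm (Fin n)) (w : Fin n → Fin n × Fin n) :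
    List.ofFn (fun t => (π t, t)) = List.ofFn w ↔
      (∀ t, (w t).2 = t) ∧ ⇑π = fun t => (w t).1 := by
  rw [List.ofFn_inj]
  constructor
  · intro h
    have h' : ∀ t, (π t, t) = w t := fun t => congrFun h t
    exact ⟨fun t => by rw [← h' t], funext fun t => by rw [← h' t]⟩
  · rintro ⟨h2, h1⟩
    funext t
    exact Prod.ext (congrFun h1 t) (h2 t).symm

/-- Counting permutations with prescribed values: `#{π : ⇑π = w₁} = perWord n w₁` (`1` iff `w₁` is
injective, i.e. a permutation of `Fin n`). [cite: Nisan1991Noncommutative, §4] -/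
theorem sum_perm_indicator {n : ℕ} (w₁ : Fin n → Fin n) :
    (∑ π : Equiv.Perm (Fin n), if ⇑π = w₁ then (1 : F) else 0) = perWord F n w₁ := by
  unfold perWord
  split_ifs with hinj
  · have hbij : Function.Bijective w₁ := Finite.injective_iff_bijective.mp hinj
    have key : ∀ π : Equiv.Perm (Fin n), (⇑π = w₁) ↔ π = Equiv.ofBijective w₁ hbij := fun π =>
      ⟨fun h => Equiv.ext fun t => by simp [← h], fun h => by subst h; rfl⟩
    simp_rw [key]
    simp
  · refine Finset.sum_eq_zero fun π _ => ?_
    rw [if_neg]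
    intro h
    exact hinj (h ▸ π.injective)

/-- **THE BRIDGE**: on words of length `n`, the word tensor of `ncPerPoly n` is Nisan's `perWord n` on
column-consistent words and `0` elsewhere. [cite: Nisan1991Noncommutative, §4] -/
theorem coeff_equiv_ncPerPoly_ofFn (n : ℕ) (w : Fin n → Fin n × Fin n) :
    (FreeAlgebra.equivMonoidAlgebraFreeMonoid (ncPerPoly (k := F) n)).coeff
        (FreeMonoid.ofList (List.ofFn w)) =
      if ∀ t, (w t).2 = t then perWord F n (fun t => (w t).1) else 0 := by
  rw [coeff_equiv_ncPerPoly]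
  have hsum : ∀ π : Equiv.Perm (Fin n),
      (if List.ofFn (fun t => (π t, t)) = FreeMonoid.toList (FreeMonoid.ofList (List.ofFn w))
        then (1 : F) else 0) =
        if (∀ t, (w t).2 = t) ∧ ⇑π = fun t => (w t).1 then (1 : F) else 0 :=
    fun π => if_congr (ofList_perm_eq_iff π w) rfl rfl
  rw [Finset.sum_congr rfl fun π _ => hsum π]
  by_cases h2 : ∀ t, (w t).2 = t
  · rw [if_pos h2, ← sum_perm_indicator (F := F) (fun t => (w t).1)]
    exact Finset.sum_congr rfl fun π _ => if_congr (and_iff_right h2) rfl rfl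
  · rw [if_neg h2]
    exact Finset.sum_eq_zero fun π _ => if_neg fun h => h2 h.1

/-- Words whose length is not `n` do not occur in `ncPerPoly n`. [cite: Nisan1991Noncommutative, §4] -/
theorem coeff_equiv_ncPerPoly_of_length_ne (n : ℕ) (u : FreeMonoid (Fin n × Fin n))
    (hu : (FreeMonoid.toList u).length ≠ n) :
    (FreeAlgebra.equivMonoidAlgebraFreeMonoid (ncPerPoly (k := F) n)).coeff u = 0 := by
  rw [coeff_equiv_ncPerPoly]
  refine Finset.sum_eq_zero fun π _ => ?_
  rw [if_neg]
  intro h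
  exact hu (by rw [← h, List.length_ofFn])

/-- Column-consistent reading: composing with the letter map `t ↦ (w₁ t, t)` recovers `perWord` on the
nose — the tensor `NisanPermanent` decides (`ncAbpWidth_perWord = C(n,⌊n/2⌋)`) is the word tensor of the
dial's target. [cite: Nisan1991Noncommutative, §4] -/
theorem coeff_equiv_ncPerPoly_rows (n : ℕ) (w₁ : Fin n → Fin n) :
    (FreeAlgebra.equivMonoidAlgebraFreeMonoid (ncPerPoly (k := F) n)).coeff
        (FreeMonoid.ofList (List.ofFn fun t => (w₁ t, t))) = perWord F n w₁ := by
  rw [coeff_equiv_ncPerPoly_ofFn]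
  simp

end Summit.ValiantsHypothesis.ValiantsHypothesis.Theorems.NcPerWordTensor
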